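import Literature.Dynamics.Ergodic.BirkhoffErgodicTheoremProofs
import Literature.Probability.LatticeModels.ThermodynamicLimit
import HarnessLib

/-!
# RSW3 lane (P2, gen 24): THE SPATIAL ERGODIC THEOREM, Ia — two-sided one-parameter ergodic averages and the slicing of cubes
# (tools for the multiparameter pointwise ergodic theorem of part Ib)

builds on p205010 (kernel theorem, internal audit signed; external expert review pending) — NOT used in this file.

Cell `prim-rsw3`, prover seat `prim-rsw3-p2` (gen 24), memo `run/shared/lean/prim/rsw3/P2-RSWLITE.md` §31.
Support file (`--supports stmt-CriticalPhenomena-4575`); no definitions, no named facts, no sorries.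

ABSTRACT SETTING (inline): a probability space `(Ω, μ)`; a `ℤ`-action `U : ℤ → Ω → Ω` (`U 0 = id`, `U (a+b) = U a ∘ U b`);
cubes of `ℤ^k` are the tree's `box k N = {−N,…,N}^k` (`|box k N| = (2N+1)^k`).

* §1 **`sum_Icc_eq_sum_range_add`** (a two-sided sum is two one-sided sums minus the centre), **`action_natCast_eq_iterate`** /
  **`action_neg_natCast_eq_iterate`** (`U n = (U 1)^[n]`, `U (−n) = (U (−1))^[n]`), `tendsto_succ_div_two_mul_succ`;
  **`ae_tendsto_twoSided_average`** — for a `ℤ`-action `U` on a probability space with `U 1` and `U (−1)` ergodic and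
  `g ∈ L¹(μ)`: for `μ`-a.e. `ω`, `(2N+1)⁻¹ Σ_{j=−N}^{N} g(U_j ω) → ∫ g dμ` (two applications of the tree's pointwise ergodic
  theorem `Literature.Dynamics.Ergodic.birkhoff_ergodic_theorem_of_ergodic_holds`, Birkhoff 1931 / Dajani–Kalle Thm 3.1.1).
* §2 slicing cubes along the first coordinate: `cons_zero_zero`, `cons_add_cons`, `cons_eq_add`, `cons_zero_ne_zero`,
  `cons_ne_zero_of_ne`, **`sum_box_succ`** (`Σ_{x ∈ box (k+1) N} F x = Σ_{j=−N}^{N} Σ_{y ∈ box k N} F (Fin.cons j y)`),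
  **`sum_box_one`**, `card_box_succ_real`, `card_box_pos_real`, `abs_inv_card_mul_sum_le`.

References: G. D. Birkhoff, Proc. Natl. Acad. Sci. 17 (1931) 656–660; K. Dajani, C. Kalle, *A First Course in Ergodic Theory* (2021),
Thm 3.1.1 [DajaniKalle2021]. [folklore]
-/

noncomputable section

namespace Summit.CriticalPhenomena.PercolationContinuityZ3.Theorems

namespace Rsw3

namespace BoxErgodic

open MeasureTheory Filter Topology Finset Literature.Probability.LatticeModels

universe u

variable {Ω : Type u} [MeasurableSpace Ω] {μ : Measure Ω}

/-! ## §1 Two-sided one-parameter averages -/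

/-- `Σ_{j ∈ [−N, N]} h(j) = Σ_{i ≤ N} h(i) + Σ_{i ≤ N} h(−i) − h(0)`. [folklore] -/
theorem sum_Icc_eq_sum_range_add (h : ℤ → ℝ) (N : ℕ) :
    ∑ j ∈ Finset.Icc (-(N : ℤ)) N, h j =
      (∑ i ∈ Finset.range (N + 1), h i) + (∑ i ∈ Finset.range (N + 1), h (-(i : ℤ))) - h 0 := by
  induction N with
  | zero => simp
  | succ N ih =>
      have hIcc : Finset.Icc (-((N + 1 : ℕ) : ℤ)) ((N + 1 : ℕ) : ℤ) =
          insert (-((N + 1 : ℕ) : ℤ)) (insert ((N + 1 : ℕ) : ℤ) (Finset.Icc (-(N : ℤ)) N)) := by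
        ext j
        simp only [Finset.mem_Icc, Finset.mem_insert]
        push_cast
        omega
      have h1 : -((N + 1 : ℕ) : ℤ) ∉ insert ((N + 1 : ℕ) : ℤ) (Finset.Icc (-(N : ℤ)) N) := by
        simp only [Finset.mem_insert, Finset.mem_Icc]
        push_cast
        omega
      have h2 : ((N + 1 : ℕ) : ℤ) ∉ Finset.Icc (-(N : ℤ)) N := by
        simp only [Finset.mem_Icc]
        push_cast
        omega
      rw [hIcc, Finset.sum_insert h1, Finset.sum_insert h2, ih, Finset.sum_range_succ _ (N + 1),
        Finset.sum_range_succ _ (N + 1)]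
      push_cast
      ring

omit [MeasurableSpace Ω] in
/-- For a `ℤ`-action `U` (`U 0 = id`, `U (a+b) = U a ∘ U b`): `U n = (U 1)^[n]`. [folklore] -/
theorem action_natCast_eq_iterate (U : ℤ → Ω → Ω) (h0 : U 0 = id) (hadd : ∀ a b, U (a + b) = U a ∘ U b)
    (n : ℕ) : U (n : ℤ) = (U 1)^[n] := by
  induction n with
  | zero => simpa using h0
  | succ n ih => rw [Function.iterate_succ', ← ih, ← hadd, Nat.cast_succ, add_comm]

omit [MeasurableSpace Ω] in
/-- For a `ℤ`-action `U`: `U (−n) = (U (−1))^[n]`. [folklore] -/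
theorem action_neg_natCast_eq_iterate (U : ℤ → Ω → Ω) (h0 : U 0 = id) (hadd : ∀ a b, U (a + b) = U a ∘ U b)
    (n : ℕ) : U (-(n : ℤ)) = (U (-1))^[n] := by
  induction n with
  | zero => simpa using h0
  | succ n ih => rw [Function.iterate_succ', ← ih, ← hadd, Nat.cast_succ, neg_add, add_comm]

/-- `(N+1)/(2N+1) → 1/2`. [folklore] -/
theorem tendsto_succ_div_two_mul_succ :
    Tendsto (fun N : ℕ => ((N : ℝ) + 1) / (2 * (N : ℝ) + 1)) atTop (𝓝 (1 / 2)) := by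
  have h2 : Tendsto (fun N : ℕ => (2 * (N : ℝ) + 1)⁻¹) atTop (𝓝 0) := by
    refine tendsto_inv_atTop_zero.comp ?_
    refine tendsto_atTop_add_const_right _ _ ?_
    exact (tendsto_natCast_atTop_atTop (R := ℝ)).const_mul_atTop (by norm_num)
  have h3 : Tendsto (fun N : ℕ => 1 / 2 + 1 / 2 * (2 * (N : ℝ) + 1)⁻¹) atTop (𝓝 (1 / 2 + 1 / 2 * 0)) :=
    tendsto_const_nhds.add (h2.const_mul _)
  rw [mul_zero, add_zero] at h3
  refine h3.congr fun N => ?_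
  have hN : (2 * (N : ℝ) + 1) ≠ 0 := by positivity
  field_simp
  ring

/-- **TWO-SIDED ONE-PARAMETER ERGODIC AVERAGES** (Birkhoff 1931, two-sided form): for a `ℤ`-action `U` on a probability space
with `U 1` and `U (−1)` ergodic and `g ∈ L¹`, for a.e. `ω`, `(2N+1)⁻¹ Σ_{j=−N}^{N} g(U_j ω) → ∫ g dμ`.
[cite: DajaniKalle2021, Thm 3.1.1] -/
theorem ae_tendsto_twoSided_average [IsProbabilityMeasure μ] (U : ℤ → Ω → Ω) (h0 : U 0 = id)
    (hadd : ∀ a b, U (a + b) = U a ∘ U b) (h1 : Ergodic (U 1) μ) (h1' : Ergodic (U (-1)) μ) {g : Ω → ℝ}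
    (hg : Integrable g μ) :
    ∀ᵐ ω ∂μ, Tendsto (fun N : ℕ => (2 * (N : ℝ) + 1)⁻¹ * ∑ j ∈ Finset.Icc (-(N : ℤ)) N, g (U j ω))
      atTop (𝓝 (∫ ω, g ω ∂μ)) := by
  have hB1 := Literature.Dynamics.Ergodic.birkhoff_ergodic_theorem_of_ergodic_holds μ (U 1) h1 g hg
  have hB2 := Literature.Dynamics.Ergodic.birkhoff_ergodic_theorem_of_ergodic_holds μ (U (-1)) h1' g hg
  filter_upwards [hB1, hB2] with ω hω₁ hω₂
  set c : ℝ := ∫ ω, g ω ∂μ with hc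
  have hsum : ∀ N : ℕ, ∑ j ∈ Finset.Icc (-(N : ℤ)) N, g (U j ω) =
      ((N : ℝ) + 1) * birkhoffAverage ℝ (U 1) g (N + 1) ω +
        ((N : ℝ) + 1) * birkhoffAverage ℝ (U (-1)) g (N + 1) ω - g ω := by
    intro N
    rw [sum_Icc_eq_sum_range_add (fun j => g (U j ω)) N]
    have hN : ((N : ℝ) + 1) ≠ 0 := by positivity
    simp only [birkhoffAverage, birkhoffSum, action_natCast_eq_iterate U h0 hadd,
      action_neg_natCast_eq_iterate U h0 hadd, h0, id, smul_eq_mul]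
    push_cast
    field_simp
  have hlim : Tendsto (fun N : ℕ => ((N : ℝ) + 1) / (2 * (N : ℝ) + 1) * birkhoffAverage ℝ (U 1) g (N + 1) ω +
      ((N : ℝ) + 1) / (2 * (N : ℝ) + 1) * birkhoffAverage ℝ (U (-1)) g (N + 1) ω -
        (2 * (N : ℝ) + 1)⁻¹ * g ω) atTop (𝓝 (1 / 2 * c + 1 / 2 * c - 0 * g ω)) := by
    have h2 : Tendsto (fun N : ℕ => (2 * (N : ℝ) + 1)⁻¹) atTop (𝓝 0) := by
      refine tendsto_inv_atTop_zero.comp ?_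
      refine tendsto_atTop_add_const_right _ _ ?_
      exact (tendsto_natCast_atTop_atTop (R := ℝ)).const_mul_atTop (by norm_num)
    have hA1 : Tendsto (fun N : ℕ => birkhoffAverage ℝ (U 1) g (N + 1) ω) atTop (𝓝 c) :=
      hω₁.comp (tendsto_add_atTop_nat 1)
    have hA2 : Tendsto (fun N : ℕ => birkhoffAverage ℝ (U (-1)) g (N + 1) ω) atTop (𝓝 c) :=
      hω₂.comp (tendsto_add_atTop_nat 1)
    exact ((tendsto_succ_div_two_mul_succ.mul hA1).add (tendsto_succ_div_two_mul_succ.mul hA2)).sub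
      (h2.mul tendsto_const_nhds)
  have hc' : 1 / 2 * c + 1 / 2 * c - 0 * g ω = c := by ring
  rw [hc'] at hlim
  refine hlim.congr fun N => ?_
  rw [hsum N]
  have hN : (2 * (N : ℝ) + 1) ≠ 0 := by positivity
  field_simp

/-! ## §2 Slicing cubes along the first coordinate -/

/-- `Fin.cons 0 0 = 0`. [folklore] -/
theorem cons_zero_zero {k : ℕ} : (Fin.cons (0 : ℤ) (0 : Fin k → ℤ) : Fin (k + 1) → ℤ) = 0 := by
  funext i
  refine Fin.cases ?_ (fun i => ?_) i
  · simp
  · simp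

/-- `Fin.cons (a + a') (y + y') = Fin.cons a y + Fin.cons a' y'`. [folklore] -/
theorem cons_add_cons {k : ℕ} (a a' : ℤ) (y y' : Fin k → ℤ) :
    (Fin.cons (a + a') (y + y') : Fin (k + 1) → ℤ) = (Fin.cons a y : Fin (k + 1) → ℤ) + Fin.cons a' y' := by
  funext i
  refine Fin.cases ?_ (fun i => ?_) i
  · simp
  · simp

/-- `Fin.cons j y = Fin.cons 0 y + Fin.cons j 0`. [folklore] -/
theorem cons_eq_add {k : ℕ} (j : ℤ) (y : Fin k → ℤ) :
    (Fin.cons j y : Fin (k + 1) → ℤ) = (Fin.cons 0 y : Fin (k + 1) → ℤ) + Fin.cons j 0 := by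
  rw [← cons_add_cons, zero_add, add_zero]

/-- `Fin.cons 0 y ≠ 0` for `y ≠ 0`. [folklore] -/
theorem cons_zero_ne_zero {k : ℕ} {y : Fin k → ℤ} (hy : y ≠ 0) : (Fin.cons 0 y : Fin (k + 1) → ℤ) ≠ 0 := by
  intro h
  apply hy
  have := congrArg Fin.tail h
  rw [Fin.tail_cons] at this
  rw [this]
  rfl

/-- `Fin.cons j 0 ≠ 0` for `j ≠ 0`. [folklore] -/
theorem cons_ne_zero_of_ne {k : ℕ} {j : ℤ} (hj : j ≠ 0) : (Fin.cons j (0 : Fin k → ℤ) : Fin (k + 1) → ℤ) ≠ 0 := by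
  intro h
  apply hj
  have := congrFun h 0
  simpa using this

/-- Slicing `box (k+1) N` along the first coordinate:
`Σ_{x ∈ box (k+1) N} F x = Σ_{j=−N}^{N} Σ_{y ∈ box k N} F (Fin.cons j y)`. [folklore] -/
theorem sum_box_succ {k : ℕ} (F : (Fin (k + 1) → ℤ) → ℝ) (N : ℕ) :
    ∑ x ∈ box (k + 1) N, F x = ∑ j ∈ Finset.Icc (-(N : ℤ)) N, ∑ y ∈ box k N, F (Fin.cons j y) := by
  rw [← Finset.sum_product']
  symm
  refine Finset.sum_bij' (fun p _ => (Fin.cons p.1 p.2 : Fin (k + 1) → ℤ)) (fun x _ => (x 0, Fin.tail x))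
    ?_ ?_ ?_ ?_ ?_
  · rintro ⟨j, y⟩ hp
    rw [Finset.mem_product, Finset.mem_Icc] at hp
    rw [mem_box]
    intro i
    refine Fin.cases ?_ (fun i => ?_) i
    · simpa using hp.1
    · simpa using (mem_box.1 hp.2) i
  · intro x hx
    rw [mem_box] at hx
    rw [Finset.mem_product, Finset.mem_Icc, mem_box]
    exact ⟨hx 0, fun i => hx i.succ⟩
  · rintro ⟨j, y⟩ _
    simp only [Fin.cons_zero, Fin.tail_cons]
  · intro x _
    exact Fin.cons_self_tail x
  · intro _ _
    rfl

/-- The one-dimensional cube: `Σ_{x ∈ box 1 N} F x = Σ_{j=−N}^{N} F (j)`. [folklore] -/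
theorem sum_box_one (F : (Fin 1 → ℤ) → ℝ) (N : ℕ) :
    ∑ x ∈ box 1 N, F x = ∑ j ∈ Finset.Icc (-(N : ℤ)) N, F (fun _ => j) := by
  symm
  refine Finset.sum_bij' (fun j _ => fun _ => j) (fun x _ => x 0) ?_ ?_ ?_ ?_ ?_
  · intro j hj
    rw [Finset.mem_Icc] at hj
    rw [mem_box]
    intro _
    exact hj
  · intro x hx
    rw [mem_box] at hx
    rw [Finset.mem_Icc]
    exact hx 0
  · intro _ _
    rfl
  · intro x _
    funext i
    rw [Subsingleton.elim i 0]
  · intro _ _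
    rfl

/-- `|box (k+1) N| = (2N+1) · |box k N|`. [folklore] -/
theorem card_box_succ_real (k N : ℕ) :
    ((box (k + 1) N).card : ℝ) = (2 * (N : ℝ) + 1) * ((box k N).card : ℝ) := by
  rw [card_box, card_box, pow_succ]
  push_cast
  ring

/-- `|box k N| > 0`. [folklore] -/
theorem card_box_pos_real (k N : ℕ) : (0 : ℝ) < ((box k N).card : ℝ) := by
  rw [card_box]
  positivity

/-- An average of values bounded by `C` in absolute value is bounded by `C`. [folklore] -/
theorem abs_inv_card_mul_sum_le {ι : Type*} (s : Finset ι) (hs : s.Nonempty) (a : ι → ℝ) {C : ℝ}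
    (hC : ∀ i ∈ s, |a i| ≤ C) : |((s.card : ℝ))⁻¹ * ∑ i ∈ s, a i| ≤ C := by
  have hcard : (0 : ℝ) < s.card := by exact_mod_cast hs.card_pos
  rw [abs_mul, abs_inv, abs_of_pos hcard, inv_mul_le_iff₀ hcard]
  calc |∑ i ∈ s, a i| ≤ ∑ i ∈ s, |a i| := Finset.abs_sum_le_sum_abs _ _
    _ ≤ ∑ i ∈ s, C := Finset.sum_le_sum hC
    _ = s.card * C := by rw [Finset.sum_const, nsmul_eq_mul]

end BoxErgodic

end Rsw3

end Summit.CriticalPhenomena.PercolationContinuityZ3.Theorems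

end
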